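import Mathlib.Analysis.Calculus.FDeriv.Basic
import Mathlib.Algebra.Module.Projective
import Mathlib.Topology.Algebra.Module.FiniteDimension
import Mathlib.Topology.Algebra.Module.ContinuousLinearMap.Idempotent
import Literature.Analysis.OperatorTheory.LyapunovPerronFixedPoint
import Literature.Analysis.OperatorTheory.CompactNearIdentityFiniteDim
import HarnessLib

/-!
# Finite-parameter steering onto the pseudo-stable set of a fixed point

Analysis/OperatorTheory proofs-layer file (theorems only, no definitions, no named facts),
continuing `LyapunovPerronFixedPoint.lean`.

**Setting.** `T : E → E` is a self-map of a real normed space with `T 0 = 0`, strictly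
differentiable at `0` with derivative `M`. The linear analysis is done in a complex Banach space
`X` containing `E` as "real part" (`ι : E → X` additive, `ℝ`-homogeneous, isometric;
`re : X → E` additive, norm-non-increasing, `re ∘ ι = id`, `re (I•ι x) = 0`; `X = ι E + I ι E`) on
which `M` is represented by `m` (`re ∘ m = M ∘ re`) — e.g. the complexification of `E` and of
`M`. The operator `m` carries dichotomy data `P, J, a < b ≤ 1, C` as in
`lyapunovPerron_fixedPoint`, and **`1 − P` is compact** (so the "unstable" space `(1 − P)X` is
finite-dimensional). `D ≤ E` is a dense submodule of admissible corrections.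

**Theorem** (`exists_trapped_orbit_of_dichotomy`). For every `η > 0` there is `r > 0` such that
every `e` with `‖e‖ < r` can be corrected by some `d ∈ D` so that the whole forward `T`-orbit of
`e + d` stays in the `η`-ball. Proof: `W = (1 − P)X` is finite-dimensional (compact idempotent)
and `(d, c) ↦ (1 − P)(ι d + I ι c)` maps the dense `D × D` onto a dense, hence full, subspace of
`W`; a linear right inverse `L : W → D × D` (automatically bounded) turns the requirement "the
unstable coordinate of the initial point equals the Lyapunov–Perron anchor `u`" into the
Lipschitz base-point map `ζ(u) = ι e + Λ'(L((1 − P)(u − ι e)))`, to which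
`lyapunovPerron_fixedPoint` applies; the real parts of the resulting orbit in `X` form the
`T`-orbit of `e + d`. (Hirsch–Pugh–Shub 1977 Thm. 5.1 / Henry 1981 Thm. 5.2.1 give the
pseudo-stable manifold; the steering step is the finite-dimensional transversality used in
blow-up constructions "modulo finitely many unstable directions".)

## References

* D. Henry, *Geometric Theory of Semilinear Parabolic Equations*, LNM 840, Springer 1981,
  Thm. 5.2.1. [Henry1981]
-/

noncomputable section

open _root_.Complex _root_.Filter _root_.Topology _root_.Metric _root_.Set

namespace Literature.Analysis.OperatorTheory

/-- **Steering onto the pseudo-stable set.** See the module docstring for the setting. Given the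
real/complex interface `ι, re`, the representation `re ∘ m = M ∘ re` of the strict derivative
`M` of `T` at its fixed point `0`, dichotomy data `P, J, a < b ≤ 1, C` for `m` with `1 − P`
compact, and a dense submodule `D`: for every `η > 0` there is `r > 0` such that for every
`‖e‖ < r` some `d ∈ D` makes `‖T^[k] (e + d)‖ < η` for all `k`. [cite: Henry1981, Thm. 5.2.1] -/
theorem exists_trapped_orbit_of_dichotomy
    {E : Type*} [NormedAddCommGroup E] [NormedSpace ℝ E]
    {X : Type*} [NormedAddCommGroup X] [NormedSpace ℂ X] [CompleteSpace X]
    {ι : E → X} {re : X → E}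
    (hιadd : ∀ x y, ι (x + y) = ι x + ι y) (hιsmul : ∀ (r : ℝ) (x : E), ι (r • x) = (r : ℂ) • ι x)
    (hιnorm : ∀ x, ‖ι x‖ = ‖x‖) (hreadd : ∀ v w, re (v + w) = re v + re w)
    (hrenorm : ∀ v, ‖re v‖ ≤ ‖v‖) (hreι : ∀ x, re (ι x) = x) (hreI : ∀ x, re (I • ι x) = 0)
    (hspan : ∀ v : X, ∃ x y : E, ι x + I • ι y = v)
    {m : X →L[ℂ] X} {M : E →L[ℝ] E} (hmre : ∀ v, re (m v) = M (re v))
    {T : E → E} (hT0 : T 0 = 0) (hT : HasStrictFDerivAt T M 0)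
    {P : X →L[ℂ] X} {J : ℕ → X →L[ℂ] X} {a b C : ℝ} (ha : 0 < a) (hab : a < b) (hb1 : b ≤ 1)
    (hC : 1 ≤ C) (hPP : P * P = P) (hmP : m * P = P * m) (hJ0 : J 0 = 1 - P)
    (hJ : ∀ n, m * J (n + 1) = J n) (hPn : ∀ n : ℕ, ‖m ^ n * P‖ ≤ C * a ^ n)
    (hJn : ∀ n : ℕ, ‖J n‖ * b ^ n ≤ C) (hQc : IsCompactOperator (⇑(1 - P : X →L[ℂ] X)))
    {D : Submodule ℝ E} (hD : Dense (D : Set E)) {η : ℝ} (hη : 0 < η) :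
    ∃ r : ℝ, 0 < r ∧ ∀ e : E, ‖e‖ < r → ∃ d ∈ D, ∀ k : ℕ, ‖T^[k] (e + d)‖ < η := by
  -- derived facts about `ι`, `re`
  have hι0 : ι 0 = 0 := by
    have h := hιsmul 0 0; rwa [zero_smul, Complex.ofReal_zero, zero_smul] at h
  have hιsub : ∀ x y, ι (x - y) = ι x - ι y := fun x y => by
    rw [eq_sub_iff_add_eq, ← hιadd, sub_add_cancel]
  have hre0 : re 0 = 0 := by rw [← hι0, hreι]
  have hresub : ∀ v w, re (v - w) = re v - re w := fun v w => by
    rw [eq_sub_iff_add_eq, ← hreadd, sub_add_cancel]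
  -- `Q = 1 − P`, its real restriction and the unstable space `W = QX`
  set Q : X →L[ℂ] X := 1 - P with hQdef
  have hQQ : Q * Q = Q := by
    rw [hQdef, mul_sub, mul_one, sub_mul, one_mul, hPP, sub_self, sub_zero]
  have hQn : ‖Q‖ ≤ C := by have h := hJn 0; rwa [hJ0, pow_zero, mul_one] at h
  have hPQ : ∀ v : X, P v + Q v = v := fun v => by rw [hQdef]; simp
  have hC0 : 0 ≤ C := zero_le_one.trans hC
  have hQv : ∀ v, ‖Q v‖ ≤ C * ‖v‖ := fun v =>
    (Q.le_opNorm v).trans (mul_le_mul_of_nonneg_right hQn (norm_nonneg _))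
  let Qr : X →L[ℝ] X := Q.restrictScalars ℝ
  let W : Submodule ℝ X := LinearMap.range (Qr : X →ₗ[ℝ] X)
  have hWmem : ∀ {w : X}, w ∈ W ↔ Q w = w := by
    intro w
    constructor
    · rintro ⟨v, rfl⟩
      change Q (Q v) = Q v
      rw [← mul_apply_eq_comp, hQQ]
    · intro h; exact ⟨w, h⟩
  have hidem : IsIdempotentElem Qr := by
    ext v; change Q (Q v) = Q v; rw [← mul_apply_eq_comp, hQQ]
  have hWclosed : IsClosed (W : Set X) := ContinuousLinearMap.IsIdempotentElem.isClosed_range hidem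
  have hQc' : IsCompactOperator (Qr : X → X) := hQc
  haveI hWfd : FiniteDimensional ℝ W :=
    finiteDimensional_of_isCompactOperator_of_norm_sub_le hQc' W hWclosed zero_lt_one
      fun v hv => by
        have h : Qr v = v := hWmem.1 hv
        rw [h, sub_self, norm_zero, zero_mul]
  -- `Λ' (d, c) = ι d + I ι c` and `Λ = Q Λ'`
  let Λ'ₗ : E × E →ₗ[ℝ] X :=
    { toFun := fun p => ι p.1 + I • ι p.2
      map_add' := fun p q => by
        simp only [Prod.fst_add, Prod.snd_add, hιadd, smul_add]; abel
      map_smul' := fun r p => by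
        change ι (r • p.1) + I • ι (r • p.2) = ((r : ℂ)) • (ι p.1 + I • ι p.2)
        rw [hιsmul, hιsmul, smul_add, smul_comm I (r : ℂ)] }
  have hΛ'b : ∀ p : E × E, ‖Λ'ₗ p‖ ≤ 2 * ‖p‖ := fun p => by
    change ‖ι p.1 + I • ι p.2‖ ≤ 2 * ‖p‖
    calc ‖ι p.1 + I • ι p.2‖ ≤ ‖ι p.1‖ + ‖I • ι p.2‖ := norm_add_le _ _
      _ = ‖p.1‖ + ‖p.2‖ := by rw [norm_smul, norm_I, one_mul, hιnorm, hιnorm]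
      _ ≤ ‖p‖ + ‖p‖ := add_le_add (norm_fst_le p) (norm_snd_le p)
      _ = 2 * ‖p‖ := by ring
  let Λ' : E × E →L[ℝ] X := Λ'ₗ.mkContinuous 2 hΛ'b
  have hΛ'apply : ∀ p, Λ' p = ι p.1 + I • ι p.2 := fun p => rfl
  have hΛ'norm : ∀ p, ‖Λ' p‖ ≤ 2 * ‖p‖ := hΛ'b
  let Λ : E × E →L[ℝ] X := Qr.comp Λ'
  have hΛapply : ∀ p, Λ p = Q (ι p.1 + I • ι p.2) := fun p => rfl
  have hΛW : ∀ p, Λ p ∈ W := fun p => ⟨Λ' p, rfl⟩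
  -- `Λ (D × D)` is all of `W`
  let W' : Submodule ℝ X := (D.prod D).map (Λ : E × E →ₗ[ℝ] X)
  have hW'W : W' ≤ W := by
    rintro _ ⟨p, -, rfl⟩; exact hΛW p
  haveI : FiniteDimensional ℝ W' := Submodule.finiteDimensional_of_le hW'W
  have hW'closed : IsClosed (W' : Set X) := Submodule.closed_of_finiteDimensional _
  have hWW' : ∀ w ∈ W, w ∈ W' := by
    intro w hw
    obtain ⟨x, y, hxy⟩ := hspan w
    have hwΛ : Λ (x, y) = w := by rw [hΛapply, hxy]; exact hWmem.1 hw
    have hcl : (x, y) ∈ closure ((D : Set E) ×ˢ (D : Set E)) := by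
      rw [(hD.prod hD).closure_eq]; exact mem_univ _
    have hmaps : MapsTo Λ ((D : Set E) ×ˢ (D : Set E)) (W' : Set X) := fun p hp =>
      Submodule.mem_map_of_mem (Submodule.mem_prod.2 ⟨hp.1, hp.2⟩)
    have h := map_mem_closure Λ.continuous hcl hmaps
    rw [hW'closed.closure_eq, hwΛ] at h
    exact h
  -- a linear right inverse `L : W → D × D` of `Λ`, bounded
  let f : (D.prod D) →ₗ[ℝ] W :=
    LinearMap.codRestrict W ((Λ : E × E →ₗ[ℝ] X).domRestrict (D.prod D)) fun p => hΛW p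
  have hfsurj : LinearMap.range f = ⊤ := by
    rw [LinearMap.range_eq_top]
    intro w
    obtain ⟨p, hp, hpw⟩ := Submodule.mem_map.1 (hWW' w w.2)
    exact ⟨⟨p, hp⟩, Subtype.ext hpw⟩
  obtain ⟨gsec, hgsec⟩ := f.exists_rightInverse_of_surjective hfsurj
  let L : W →ₗ[ℝ] E × E := (D.prod D).subtype.comp gsec
  have hLΛ : ∀ w : W, Q (Λ' (L w)) = w := fun w => by
    have h := LinearMap.congr_fun hgsec w
    simp only [LinearMap.comp_apply, LinearMap.id_apply] at h
    exact congrArg Subtype.val h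
  have hLD : ∀ w : W, (L w).1 ∈ D := fun w => (Submodule.mem_prod.1 (gsec w).2).1
  let Lc : W →L[ℝ] E × E := LinearMap.toContinuousLinearMap L
  set CL : ℝ := ‖Lc‖ with hCL
  have hCL0 : 0 ≤ CL := by rw [hCL]; exact norm_nonneg Lc
  have hLc : ∀ w : W, ‖L w‖ ≤ CL * ‖w‖ := fun w => Lc.le_opNorm w
  -- the Lyapunov–Perron constant
  set Cζ : ℝ := 2 * CL * C with hCζ
  have hCζ0 : 0 ≤ Cζ := by positivity
  obtain ⟨ε, hε, hLP⟩ := lyapunovPerron_fixedPoint ha hab hb1 hC hCζ0 hPP hmP hJ0 hJ hPn hJn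
  -- the nonlinearity `G v = ι (T (re v) − M (re v))` is `ε`-Lipschitz on a small ball
  obtain ⟨δ₀, hδ₀, hδ⟩ : ∃ δ₀ > 0, ∀ p q : E, ‖p‖ < δ₀ → ‖q‖ < δ₀ →
      ‖T p - T q - M (p - q)‖ ≤ ε * ‖p - q‖ := by
    have h := hT.isLittleO.def hε
    obtain ⟨δ₀, hδ₀, hball⟩ := Metric.eventually_nhds_iff.1 h
    refine ⟨δ₀, hδ₀, fun p q hp hq => ?_⟩
    have hd : dist (p, q) ((0 : E), (0 : E)) < δ₀ := by
      rw [dist_eq_norm]; simp [hp, hq]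
    exact hball hd
  set δ : ℝ := δ₀ / 2 with hδdef
  let G : X → X := fun v => ι (T (re v) - M (re v))
  have hG0 : G 0 = 0 := by simp only [G, hre0, hT0, map_zero, sub_zero, hι0]
  have hG : ∀ v w, ‖v‖ ≤ δ → ‖w‖ ≤ δ → ‖G v - G w‖ ≤ ε * ‖v - w‖ := by
    intro v w hv hw
    have hv' : ‖re v‖ < δ₀ := (hrenorm v).trans_lt (hv.trans_lt (by rw [hδdef]; linarith))
    have hw' : ‖re w‖ < δ₀ := (hrenorm w).trans_lt (hw.trans_lt (by rw [hδdef]; linarith))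
    calc ‖G v - G w‖ = ‖(T (re v) - M (re v)) - (T (re w) - M (re w))‖ := by
          simp only [G]; rw [← hιsub, hιnorm]
      _ = ‖T (re v) - T (re w) - M (re v - re w)‖ := by rw [map_sub]; abel_nf
      _ ≤ ε * ‖re v - re w‖ := hδ _ _ hv' hw'
      _ ≤ ε * ‖v - w‖ := by
          rw [← hresub]; exact mul_le_mul_of_nonneg_left (hrenorm _) hε.le
  -- the sizes
  set η' : ℝ := min δ (η / 2) with hη'def
  have hη' : 0 < η' := lt_min (by rw [hδdef]; linarith) (by linarith)
  have hη'δ : η' ≤ δ := min_le_left _ _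
  have hη'η : η' < η := (min_le_right _ _).trans_lt (by linarith)
  set Kr : ℝ := C * (1 + 2 * CL * C) with hKr
  have hKr0 : 0 ≤ Kr := by positivity
  refine ⟨η' / (8 * Kr + 1), by positivity, fun e he => ?_⟩
  -- the base-point map `ζ`
  have hwmem : ∀ u : X, Q (u - ι e) ∈ W := fun u => ⟨u - ι e, rfl⟩
  let ζ : X → X := fun u => ι e + Λ' (L ⟨Q (u - ι e), hwmem u⟩)
  have hζlip : ∀ u u', ‖ζ u - ζ u'‖ ≤ Cζ * ‖u - u'‖ := by
    intro u u'
    have hsub : ζ u - ζ u' = Λ' (L (⟨Q (u - ι e), hwmem u⟩ - ⟨Q (u' - ι e), hwmem u'⟩)) := by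
      simp only [ζ, map_sub]; abel
    have hn : ‖(⟨Q (u - ι e), hwmem u⟩ - ⟨Q (u' - ι e), hwmem u'⟩ : W)‖ = ‖Q (u - u')‖ := by
      change ‖Q (u - ι e) - Q (u' - ι e)‖ = _
      rw [← map_sub]; congr 2; abel
    rw [hsub]
    calc ‖Λ' (L _)‖ ≤ 2 * ‖L _‖ := hΛ'norm _
      _ ≤ 2 * (CL * ‖(⟨Q (u - ι e), hwmem u⟩ - ⟨Q (u' - ι e), hwmem u'⟩ : W)‖) := by
          gcongr; exact hLc _
      _ = 2 * (CL * ‖Q (u - u')‖) := by rw [hn]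
      _ ≤ 2 * (CL * (C * ‖u - u'‖)) := by gcongr; exact hQv _
      _ = Cζ * ‖u - u'‖ := by rw [hCζ]; ring
  have hζ0 : C * ‖ζ 0‖ ≤ η' / 8 := by
    have h1 : ‖ζ 0‖ ≤ (1 + 2 * CL * C) * ‖e‖ := by
      change ‖ι e + Λ' (L ⟨Q (0 - ι e), hwmem 0⟩)‖ ≤ _
      have hn : ‖(⟨Q (0 - ι e), hwmem 0⟩ : W)‖ ≤ C * ‖e‖ := by
        change ‖Q (0 - ι e)‖ ≤ _
        rw [zero_sub, map_neg, norm_neg, ← hιnorm e]; exact hQv _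
      calc ‖ι e + Λ' (L ⟨Q (0 - ι e), hwmem 0⟩)‖
          ≤ ‖ι e‖ + ‖Λ' (L ⟨Q (0 - ι e), hwmem 0⟩)‖ := norm_add_le _ _
        _ ≤ ‖e‖ + 2 * (CL * (C * ‖e‖)) := by
            rw [hιnorm]
            gcongr
            exact (hΛ'norm _).trans (by gcongr; exact (hLc _).trans (by gcongr))
        _ = (1 + 2 * CL * C) * ‖e‖ := by ring
    calc C * ‖ζ 0‖ ≤ C * ((1 + 2 * CL * C) * ‖e‖) := by gcongr
      _ = Kr * ‖e‖ := by rw [hKr]; ring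
      _ ≤ Kr * (η' / (8 * Kr + 1)) := by gcongr
      _ ≤ η' / 8 := by
          rw [mul_div_assoc', div_le_div_iff₀ (by positivity) (by norm_num)]
          nlinarith [hη'.le, hKr0]
  -- the Lyapunov–Perron orbit
  obtain ⟨x, u, hQu, hx0, hxη, hxorb⟩ := hLP G ζ δ η' hη' hη'δ hG0 hG hζlip hζ0
  set w : W := ⟨Q (u - ι e), hwmem u⟩ with hw
  refine ⟨(L w).1, hLD w, fun k => ?_⟩
  have hQζ : Q (ζ u) = u := by
    change Q (ι e + Λ' (L w)) = u
    rw [map_add, hLΛ w]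
    change Q (ι e) + Q (u - ι e) = u
    rw [map_sub, hQu]; abel
  have hx0' : x 0 = ζ u := by
    rw [hx0]
    conv_rhs => rw [← hPQ (ζ u)]
    rw [hQζ]
  have hre0' : re (x 0) = e + (L w).1 := by
    rw [hx0']
    change re (ι e + Λ' (L w)) = e + (L w).1
    rw [hreadd, hreι, hΛ'apply, hreadd, hreι, hreI, add_zero]
  have hrek : ∀ k, re (x k) = T^[k] (e + (L w).1) := by
    intro k
    induction k with
    | zero => simpa using hre0'
    | succ k ih =>
      rw [Function.iterate_succ_apply', ← ih, hxorb, hreadd, hmre]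
      change M (re (x k)) + re (ι (T (re (x k)) - M (re (x k)))) = T (re (x k))
      rw [hreι]; abel
  rw [← hrek k]
  exact ((hrenorm _).trans (hxη k)).trans_lt hη'η

end Literature.Analysis.OperatorTheory
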